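import Literature.NumberTheory.EllipticCurves.SharpFlatPAdicLFunctionCoeffField
import Literature.NumberTheory.EllipticCurves.PAdicPowerSeriesZeros
import Literature.NumberTheory.EllipticCurves.PAdicLFunctionInterpolationProofs
import Mathlib.NumberTheory.Padics.Complex
import Mathlib.Analysis.Normed.Group.Ultra
import HarnessLib

/-!
# The valuation SOCKET of RSL_g's N2 (k1-g3 H5/H5≤/H5=/H6): the norm-λ index of a bounded power series is read off ‖F(z)‖ on the
# outer annulus of the open unit disc of `ℂ_p`, and `λ_G ≤ λ_F` follows from a cross-ratio inequality at pairs of radii `→ 1`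

Route `ResidualThetaTransportAtTwo` (RTT), crux RSL_g `ResidualSignedLambdaLowerCMAtTwo` (stmt-BirchSwinnertonDyer-22608): STUB-PLAN rev 4 §3.2
`stub_colemanValueIndex` socket `hcol : d ≤ normλ(Col⁺_g(loc₂ z))` := H6. Seat `prover-bsd-wall-rtt-p2` g15 (`--supports`, closes nothing).
Adapted from the crux sketch `Cruxes/ResidualThetaCountLowerPureAtTwo/Sketch_sidea_k1_g3.lean` §A–§B (stub-ideation k1 g3; kernel-checked there,
not importable; its `structure IsNormLambdaIndex` and `abbrev coeffToCp` are INLINED here as explicit hypotheses / an arbitrary norm-preserving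
ring map `φ : 𝒪 →+* ℂ_p`, so this file is THEOREMS ONLY). Pure `p`-adic analysis; nothing about Selmer groups; BSD is not proved by any of this.

## What
* §A (`ℂ_p`): **`norm_tsum_eq_of_normLambdaIndex`** (H5, dominant term: if `d` is the first index of maximal norm of the bounded sequence `a`,
  then `‖Σ a_k z^k‖ = ‖a_d‖·‖z‖^d` for `‖z‖ < 1` close to `1`); **`normLambdaIndex_le_of_ratio_le`** (H5≤: the cross-ratio inequality
  `‖F(x)‖‖G(y)‖ ≤ ‖F(y)‖‖G(x)‖` at pairs `r < ‖x‖ < ‖y‖ < 1` for every `r < 1` forces `d_G ≤ d_F`); `normLambdaIndex_eq_of_ratio_eq` (H5=).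
* §B (`𝒪⟦T⟧`, any normed ring `𝒪` with a norm-preserving `φ : 𝒪 →+* ℂ_p`): `normLambdaIndex_coeff_map` (the stub's `normλ` binders for `F ≠ 0`
  give H5's hypotheses for `k ↦ φ(F_k)`), **`normLambda_le_of_value_ratio_le_map`** (H6: `d_G ≤ d_F` from the cross-ratio inequality at `p`-power
  roots of unity `ζ − 1`, `ζ' − 1` of radii `→ 1`), and the specialisation `normLambda_le_of_value_ratio_le` to `𝒪 = padicCoeffIntegers S`,
  `Λ_𝒪 = IwasawaAlgebraO S`, `φ = ℚ̄_p ↪ ℂ_p` (`PadicComplex.norm_extends`) = the sketch's H6 verbatim. Radii: `LocalFields.norm_sub_one_eq_rpow_of_isPrimitiveRoot`.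

* §C (appended) **`eval₂_eq_mul_tsum_of_isCongrModOmegaO`** (k1-g3 H7: `IsCongrModOmegaO S n θ (w·L)` and `ζ^{pⁿ} = 1` give
  `θ(ζ−1) = w(ζ−1)·L(ζ−1)` in `ℂ_p`), `norm_eval₂_eq_of_isCongrModOmegaO` (H7′), `norm_map_coeff_mul_le` (products of bounded series are bounded).

References: [Washington1997] §7.1 Prop. 7.2–Thm. 7.3, §7.2 (values `f(ζ−1)`); [Lang1990] Ch. 5 §2 Thm. 2.2; [Robert2000PadicAnalysis] Ch. VI §1.
-/

set_option autoImplicit false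
-- the Theorems namespace of this sub repeats the summit name by design (D-0017 nested layout)
set_option linter.dupNamespace false

noncomputable section

open scoped Classical

namespace Summit.BirchSwinnertonDyer.BirchSwinnertonDyer.Theorems.NormLambdaSocket

-- adapted from Cruxes/ResidualThetaCountLowerPureAtTwo/Sketch_sidea_k1_g3.lean §A–§B (stub-ideation k1 g3)

open Literature.NumberTheory.EllipticCurves

variable {p : ℕ} [Fact p.Prime]

/-! ## §A Bounded coefficient sequences on the open unit disc of `ℂ_p` -/

section Annulus

/-- **H5. Dominant term on the outer annulus.** If `d` is the FIRST index at which the bounded sequence `a : ℕ → ℂ_p` attains its maximal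
norm (`‖a k‖ ≤ ‖a d‖` for all `k`, `<` for `k < d`, `a d ≠ 0` — the `normλ` binders of RSL_g for `Lm`, read in `ℂ_p`), then for `‖z‖ < 1` close
enough to `1`, `‖Σ a_k z^k‖ = ‖a_d‖·‖z‖^d` (every other term is strictly smaller; `ℂ_p` is ultrametric).
[cite: Washington1997, §7.1 Prop. 7.2–Thm. 7.3] [cite: Lang1990, Ch. 5 §2 Thm. 2.2] -/
theorem norm_tsum_eq_of_normLambdaIndex {a : ℕ → ℂ_[p]} {d : ℕ} (hle : ∀ k, ‖a k‖ ≤ ‖a d‖)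
    (hlt : ∀ k < d, ‖a k‖ < ‖a d‖) (hd : a d ≠ 0) :
    ∃ r : ℝ, r < 1 ∧ ∀ z : ℂ_[p], r < ‖z‖ → ‖z‖ < 1 → ‖∑' k, a k * z ^ k‖ = ‖a d‖ * ‖z‖ ^ d := by
  set A : ℝ := ‖a d‖ with hA_def
  have hA : 0 < A := norm_pos_iff.mpr hd
  -- the lower coefficients are uniformly smaller: `‖a k‖ ≤ ρ·A` for `k < d`, some `0 ≤ ρ < 1`
  obtain ⟨ρ, hρ0, hρ1, hρ⟩ : ∃ ρ : ℝ, 0 ≤ ρ ∧ ρ < 1 ∧ ∀ k < d, ‖a k‖ ≤ ρ * A := by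
    by_cases hd0 : d = 0
    · exact ⟨0, le_rfl, one_pos, fun k hk ↦ absurd hk (by omega)⟩
    · have hne : (Finset.range d).Nonempty := Finset.nonempty_range_iff.mpr hd0
      obtain ⟨k₀, hk₀, hmax⟩ := Finset.exists_max_image (Finset.range d) (fun k ↦ ‖a k‖) hne
      refine ⟨‖a k₀‖ / A, div_nonneg (norm_nonneg _) hA.le, ?_, fun k hk ↦ ?_⟩
      · rw [div_lt_one hA]; exact hlt k₀ (Finset.mem_range.mp hk₀)
      · rw [div_mul_cancel₀ _ hA.ne']; exact hmax k (Finset.mem_range.mpr hk)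
  -- radii close to `1`: `ρ < ‖z‖^d`
  have hev : ∀ᶠ t : ℝ in nhds 1, ρ < t ^ d :=
    ((continuous_pow d).tendsto (1 : ℝ)).eventually_const_lt (by rw [one_pow]; exact hρ1)
  obtain ⟨ε, hε, hball⟩ := Metric.eventually_nhds_iff.mp hev
  refine ⟨max (1 - ε) 0, max_lt (by linarith) one_pos, fun z hrz hz1 ↦ ?_⟩
  have hrz' : 1 - ε < ‖z‖ := lt_of_le_of_lt (le_max_left _ _) hrz
  have hz0' : 0 < ‖z‖ := lt_of_le_of_lt (le_max_right _ _) hrz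
  have hzd : ρ < ‖z‖ ^ d := hball (by rw [Real.dist_eq, abs_sub_comm, abs_of_pos (by linarith)]; linarith)
  have hz0 : 0 ≤ ‖z‖ := norm_nonneg _
  -- summability (domination by the geometric series `A ‖z‖^k`)
  set f : ℕ → ℂ_[p] := fun k ↦ a k * z ^ k with hf_def
  have hs : Summable f := by
    refine Summable.of_norm_bounded (g := fun k ↦ A * ‖z‖ ^ k)
      ((summable_geometric_of_lt_one hz0 hz1).mul_left A) fun k ↦ ?_
    rw [hf_def, norm_mul, norm_pow]
    exact mul_le_mul_of_nonneg_right (hle k) (pow_nonneg hz0 _)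
  -- split off the dominant term
  have hsplit : ∑' k, f k = f d + ∑' k, (if k = d then 0 else f k) := hs.tsum_eq_add_tsum_ite d
  -- the remainder is uniformly SMALLER than the dominant term
  set C : ℝ := max (A * ‖z‖ ^ (d + 1)) (ρ * A) with hC_def
  have hC0 : 0 ≤ C := le_max_of_le_right (mul_nonneg hρ0 hA.le)
  have hdom : ‖f d‖ = A * ‖z‖ ^ d := by rw [hf_def, norm_mul, norm_pow]
  have hClt : C < A * ‖z‖ ^ d := by
    refine max_lt ?_ ?_
    · rw [pow_succ, ← mul_assoc]
      exact mul_lt_of_lt_one_right (mul_pos hA (pow_pos hz0' _)) hz1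
    · calc ρ * A < ‖z‖ ^ d * A := mul_lt_mul_of_pos_right hzd hA
        _ = A * ‖z‖ ^ d := mul_comm _ _
  have hrem : ‖∑' k, (if k = d then 0 else f k)‖ ≤ C := by
    refine IsUltrametricDist.norm_tsum_le_of_forall_le_of_nonneg hC0 fun k ↦ ?_
    by_cases hkd : k = d
    · rw [if_pos hkd, norm_zero]; exact hC0
    · rw [if_neg hkd, hf_def, norm_mul, norm_pow]
      rcases lt_or_gt_of_ne hkd with hk | hk
      · -- `k < d`: `‖a k‖ ‖z‖^k ≤ ‖a k‖ ≤ ρ A`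
        calc ‖a k‖ * ‖z‖ ^ k ≤ ‖a k‖ * 1 :=
              mul_le_mul_of_nonneg_left (pow_le_one₀ hz0 hz1.le) (norm_nonneg _)
          _ ≤ ρ * A := by rw [mul_one]; exact hρ k hk
          _ ≤ C := le_max_right _ _
      · -- `k > d`: `‖a k‖ ‖z‖^k ≤ A ‖z‖^(d+1)`
        calc ‖a k‖ * ‖z‖ ^ k ≤ A * ‖z‖ ^ (d + 1) :=
              mul_le_mul (hle k) (pow_le_pow_of_le_one hz0 hz1.le (by omega)) (pow_nonneg hz0 _) hA.le
          _ ≤ C := le_max_left _ _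
  have hne : ‖f d‖ ≠ ‖∑' k, (if k = d then 0 else f k)‖ := by
    rw [hdom]; exact (ne_of_gt (hrem.trans_lt hClt))
  change ‖∑' k, f k‖ = A * ‖z‖ ^ d
  rw [hsplit, IsUltrametricDist.norm_add_eq_max_of_norm_ne_norm hne, max_eq_left, hdom]
  rw [hdom]; exact (hrem.trans_lt hClt).le

/-- **H5≤ (PROVED from H5). Ratio-monotonicity criterion — the weakest sufficient (and necessary) form of
«`λ_G ≤ λ_F`».**  If for radii arbitrarily close to `1` there are two points `‖x‖ < ‖y‖ < 1` at which the ratio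
`‖F‖/‖G‖` does not decrease from `x` to `y` (cross-multiplied, so no division and no non-vanishing is asked), then the
`normλ`-index of `G` is at most that of `F`.  Per-point scalars of norm `1`, a common constant of ANY norm, and the
`μ`-invariants are invisible to the hypothesis; only the pair of radii matters. [cite: Washington1997, §7.1 Thm. 7.3 and §7.2] -/
theorem normLambdaIndex_le_of_ratio_le {a b : ℕ → ℂ_[p]} {dF dG : ℕ}
    (hale : ∀ k, ‖a k‖ ≤ ‖a dF‖) (halt : ∀ k < dF, ‖a k‖ < ‖a dF‖) (hane : a dF ≠ 0)
    (hble : ∀ k, ‖b k‖ ≤ ‖b dG‖) (hblt : ∀ k < dG, ‖b k‖ < ‖b dG‖) (hbne : b dG ≠ 0)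
    (h : ∀ r : ℝ, r < 1 → ∃ x y : ℂ_[p], r < ‖x‖ ∧ ‖x‖ < ‖y‖ ∧ ‖y‖ < 1 ∧
      ‖∑' k, a k * x ^ k‖ * ‖∑' k, b k * y ^ k‖ ≤ ‖∑' k, a k * y ^ k‖ * ‖∑' k, b k * x ^ k‖) :
    dG ≤ dF := by
  obtain ⟨rF, hrF1, hF⟩ := norm_tsum_eq_of_normLambdaIndex hale halt hane
  obtain ⟨rG, hrG1, hG⟩ := norm_tsum_eq_of_normLambdaIndex hble hblt hbne
  obtain ⟨x, y, hrx, hxy, hy1, hle⟩ := h (max (max rF rG) 0) (max_lt (max_lt hrF1 hrG1) one_pos)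
  have hx0 : 0 < ‖x‖ := lt_of_le_of_lt (le_max_right _ _) hrx
  have hy0 : 0 < ‖y‖ := hx0.trans hxy
  have hx1 : ‖x‖ < 1 := hxy.trans hy1
  have hrFx : rF < ‖x‖ := lt_of_le_of_lt ((le_max_left _ _).trans (le_max_left _ _)) hrx
  have hrGx : rG < ‖x‖ := lt_of_le_of_lt ((le_max_right _ _).trans (le_max_left _ _)) hrx
  rw [hF x hrFx hx1, hF y (hrFx.trans hxy) hy1, hG x hrGx hx1, hG y (hrGx.trans hxy) hy1] at hle
  have haF : 0 < ‖a dF‖ := norm_pos_iff.mpr hane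
  have hbG : 0 < ‖b dG‖ := norm_pos_iff.mpr hbne
  -- `‖x‖^dF ‖y‖^dG ≤ ‖y‖^dF ‖x‖^dG`
  have key : ‖x‖ ^ dF * ‖y‖ ^ dG ≤ ‖y‖ ^ dF * ‖x‖ ^ dG := by
    have e1 : ‖a dF‖ * ‖x‖ ^ dF * (‖b dG‖ * ‖y‖ ^ dG) = (‖a dF‖ * ‖b dG‖) * (‖x‖ ^ dF * ‖y‖ ^ dG) := by ring
    have e2 : ‖a dF‖ * ‖y‖ ^ dF * (‖b dG‖ * ‖x‖ ^ dG) = (‖a dF‖ * ‖b dG‖) * (‖y‖ ^ dF * ‖x‖ ^ dG) := by ring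
    rw [e1, e2] at hle
    exact le_of_mul_le_mul_left hle (mul_pos haF hbG)
  by_contra hlt
  push Not at hlt
  -- write `dG = dF + e` with `e ≥ 1`; then `‖y‖^e ≤ ‖x‖^e`, contradicting `‖x‖ < ‖y‖`
  obtain ⟨e, rfl⟩ := Nat.exists_eq_add_of_lt hlt
  have hxy' : ‖x‖ ^ (e + 1) < ‖y‖ ^ (e + 1) := pow_lt_pow_left₀ hxy (norm_nonneg _) (Nat.succ_ne_zero e)
  have key' : (‖x‖ ^ dF * ‖y‖ ^ dF) * ‖y‖ ^ (e + 1) ≤ (‖x‖ ^ dF * ‖y‖ ^ dF) * ‖x‖ ^ (e + 1) := by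
    have e1 : ‖x‖ ^ dF * ‖y‖ ^ (dF + e + 1) = (‖x‖ ^ dF * ‖y‖ ^ dF) * ‖y‖ ^ (e + 1) := by ring
    have e2 : ‖y‖ ^ dF * ‖x‖ ^ (dF + e + 1) = (‖x‖ ^ dF * ‖y‖ ^ dF) * ‖x‖ ^ (e + 1) := by ring
    rw [← e1, ← e2]; exact key
  have hpos : 0 < ‖x‖ ^ dF * ‖y‖ ^ dF := mul_pos (pow_pos hx0 _) (pow_pos hy0 _)
  exact absurd (le_of_mul_le_mul_left key' hpos) (not_le.mpr hxy')

/-- **H5= (PROVED from H5≤). Ratio-constancy gives EQUAL `normλ`-indices** (the equality road F-eq / RSCE: if the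
per-level discrepancy between the Coleman side and the Pollack side is eventually CONSTANT in norm, `λ` agrees).
[cite: Washington1997, §7.1 Thm. 7.3 and §7.2] -/
theorem normLambdaIndex_eq_of_ratio_eq {a b : ℕ → ℂ_[p]} {dF dG : ℕ}
    (hale : ∀ k, ‖a k‖ ≤ ‖a dF‖) (halt : ∀ k < dF, ‖a k‖ < ‖a dF‖) (hane : a dF ≠ 0)
    (hble : ∀ k, ‖b k‖ ≤ ‖b dG‖) (hblt : ∀ k < dG, ‖b k‖ < ‖b dG‖) (hbne : b dG ≠ 0)
    (h : ∀ r : ℝ, r < 1 → ∃ x y : ℂ_[p], r < ‖x‖ ∧ ‖x‖ < ‖y‖ ∧ ‖y‖ < 1 ∧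
      ‖∑' k, a k * x ^ k‖ * ‖∑' k, b k * y ^ k‖ = ‖∑' k, a k * y ^ k‖ * ‖∑' k, b k * x ^ k‖) :
    dF = dG := by
  refine le_antisymm (normLambdaIndex_le_of_ratio_le hble hblt hbne hale halt hane fun r hr ↦ ?_)
    (normLambdaIndex_le_of_ratio_le hale halt hane hble hblt hbne fun r hr ↦ ?_)
  · obtain ⟨x, y, hrx, hxy, hy1, heq⟩ := h r hr
    exact ⟨x, y, hrx, hxy, hy1, by rw [mul_comm, ← heq, mul_comm]⟩
  · obtain ⟨x, y, hrx, hxy, hy1, heq⟩ := h r hr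
    exact ⟨x, y, hrx, hxy, hy1, heq.le⟩

end Annulus

/-! ## §B The route's currency: `F, G ∈ 𝒪⟦T⟧`, values through a norm-preserving `φ : 𝒪 →+* ℂ_p` -/

section Coeff

variable {O : Type*} [NormedRing O] (φ : O →+* ℂ_[p]) (hφ : ∀ c, ‖φ c‖ = ‖c‖)
include hφ

/-- The stub's `normλ` binders for `F ∈ 𝒪⟦T⟧ ∖ 0` at `d` give H5's hypotheses for the `ℂ_p`-coefficient sequence `k ↦ φ(F_k)` (`φ` norm
preserving; `φ(F_d) ≠ 0` since otherwise all coefficients vanish). [cite: Washington1997, §7.1] -/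
theorem normLambdaIndex_coeff_map {F : PowerSeries O} {d : ℕ} (hF : F ≠ 0)
    (hle : ∀ k, ‖PowerSeries.coeff k F‖ ≤ ‖PowerSeries.coeff d F‖)
    (hlt : ∀ k < d, ‖PowerSeries.coeff k F‖ < ‖PowerSeries.coeff d F‖) :
    (∀ k, ‖φ (PowerSeries.coeff k F)‖ ≤ ‖φ (PowerSeries.coeff d F)‖) ∧
      (∀ k < d, ‖φ (PowerSeries.coeff k F)‖ < ‖φ (PowerSeries.coeff d F)‖) ∧ φ (PowerSeries.coeff d F) ≠ 0 := by
  refine ⟨fun k ↦ by simpa only [hφ] using hle k, fun k hk ↦ by simpa only [hφ] using hlt k hk, fun h0 ↦ ?_⟩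
  have hd0 : PowerSeries.coeff d F = 0 := by
    have : ‖φ (PowerSeries.coeff d F)‖ = 0 := by rw [h0, norm_zero]
    rwa [hφ, norm_eq_zero] at this
  apply hF
  ext k
  have hk := hle k
  rw [hd0, norm_zero] at hk
  rw [map_zero]
  exact norm_le_zero_iff.mp hk

/-- **H6. The RSL_g socket in valuation form.** `G = Lm` with its `normλ`-index `dG = d` (the stub's binders), `F = Col⁺_g(loc₂ z)` with index `dF`;
if at pairs of points `ζ − 1`, `ζ' − 1` (`ζ, ζ'` `p`-power roots of unity, `‖ζ−1‖ < ‖ζ'−1‖ < 1`, radii `→ 1`) the cross-ratio inequality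
`‖F(ζ−1)‖·‖G(ζ'−1)‖ ≤ ‖F(ζ'−1)‖·‖G(ζ−1)‖` holds for radii arbitrarily close to `1`, then `dG ≤ dF = λ(F)` — all the analytic input the
λ-INEQUALITY consumes from the explicit reciprocity law (values enter only through norms of ratios at two levels per window; any norm-preserving
`φ : 𝒪 →+* ℂ_p`). [cite: Washington1997, §7.2] [cite: Lang1990, Ch. 5 §2 Thm. 2.2] -/
theorem normLambda_le_of_value_ratio_le_map {F G : PowerSeries O} {dF dG : ℕ} (hF : F ≠ 0) (hG : G ≠ 0)
    (hFle : ∀ k, ‖PowerSeries.coeff k F‖ ≤ ‖PowerSeries.coeff dF F‖)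
    (hFlt : ∀ k < dF, ‖PowerSeries.coeff k F‖ < ‖PowerSeries.coeff dF F‖)
    (hGle : ∀ k, ‖PowerSeries.coeff k G‖ ≤ ‖PowerSeries.coeff dG G‖)
    (hGlt : ∀ k < dG, ‖PowerSeries.coeff k G‖ < ‖PowerSeries.coeff dG G‖)
    (h : ∀ r : ℝ, r < 1 → ∃ ζ ζ' : ℂ_[p], (∃ n, ζ ^ p ^ n = 1) ∧ (∃ n, ζ' ^ p ^ n = 1) ∧
      r < ‖ζ - 1‖ ∧ ‖ζ - 1‖ < ‖ζ' - 1‖ ∧ ‖ζ' - 1‖ < 1 ∧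
      ‖∑' k, φ (PowerSeries.coeff k F) * (ζ - 1) ^ k‖ * ‖∑' k, φ (PowerSeries.coeff k G) * (ζ' - 1) ^ k‖ ≤
        ‖∑' k, φ (PowerSeries.coeff k F) * (ζ' - 1) ^ k‖ * ‖∑' k, φ (PowerSeries.coeff k G) * (ζ - 1) ^ k‖) :
    dG ≤ dF := by
  obtain ⟨hale, halt, hane⟩ := normLambdaIndex_coeff_map φ hφ hF hFle hFlt
  obtain ⟨hble, hblt, hbne⟩ := normLambdaIndex_coeff_map φ hφ hG hGle hGlt
  refine normLambdaIndex_le_of_ratio_le hale halt hane hble hblt hbne fun r hr ↦ ?_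
  obtain ⟨ζ, ζ', -, -, hrx, hxy, hy1, hle⟩ := h r hr
  exact ⟨ζ - 1, ζ' - 1, hrx, hxy, hy1, hle⟩

end Coeff

section CruxCurrency

variable (S : Set (PadicAlgCl p))

/-- **H6 on the crux's carriers** `𝒪 = padicCoeffIntegers S ⊆ ℚ̄_p`, `Λ_𝒪 = IwasawaAlgebraO S`, values in `ℂ_p` through `ℚ̄_p ↪ ℂ_p`
(`PadicComplex.norm_extends`) — the sketch's `normLambda_le_of_value_ratio_le` verbatim up to unfolding `coeffToCp`.
[cite: Washington1997, §7.2] [cite: Lang1990, Ch. 5 §2 Thm. 2.2] -/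
theorem normLambda_le_of_value_ratio_le {F G : IwasawaAlgebraO S} {dF dG : ℕ} (hF : F ≠ 0) (hG : G ≠ 0)
    (hFle : ∀ k, ‖PowerSeries.coeff k F‖ ≤ ‖PowerSeries.coeff dF F‖)
    (hFlt : ∀ k < dF, ‖PowerSeries.coeff k F‖ < ‖PowerSeries.coeff dF F‖)
    (hGle : ∀ k, ‖PowerSeries.coeff k G‖ ≤ ‖PowerSeries.coeff dG G‖)
    (hGlt : ∀ k < dG, ‖PowerSeries.coeff k G‖ < ‖PowerSeries.coeff dG G‖)
    (h : ∀ r : ℝ, r < 1 → ∃ ζ ζ' : ℂ_[p], (∃ n, ζ ^ p ^ n = 1) ∧ (∃ n, ζ' ^ p ^ n = 1) ∧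
      r < ‖ζ - 1‖ ∧ ‖ζ - 1‖ < ‖ζ' - 1‖ ∧ ‖ζ' - 1‖ < 1 ∧
      ‖∑' k, ((algebraMap (PadicAlgCl p) ℂ_[p]).comp (padicCoeffIntegers S).subtype) (PowerSeries.coeff k F) * (ζ - 1) ^ k‖ *
          ‖∑' k, ((algebraMap (PadicAlgCl p) ℂ_[p]).comp (padicCoeffIntegers S).subtype) (PowerSeries.coeff k G) * (ζ' - 1) ^ k‖ ≤
        ‖∑' k, ((algebraMap (PadicAlgCl p) ℂ_[p]).comp (padicCoeffIntegers S).subtype) (PowerSeries.coeff k F) * (ζ' - 1) ^ k‖ *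
          ‖∑' k, ((algebraMap (PadicAlgCl p) ℂ_[p]).comp (padicCoeffIntegers S).subtype) (PowerSeries.coeff k G) * (ζ - 1) ^ k‖) :
    dG ≤ dF :=
  normLambda_le_of_value_ratio_le_map ((algebraMap (PadicAlgCl p) ℂ_[p]).comp (padicCoeffIntegers S).subtype)
    (fun c ↦ PadicComplex.norm_extends (p := p) (c : PadicAlgCl p)) hF hG hFle hFlt hGle hGlt h

end CruxCurrency

/-! ## §C (appended, rtt-p2 g15) k1-g3 H7: an `ω_n`-congruence in `𝒪⟦T⟧ ⊗ ℚ` evaluates at the `pⁿ`-th roots of unity -/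

section Eval

open Polynomial

variable (S : Set (PadicAlgCl p))

/-- The images in `ℂ_p` of the coefficients of a polynomial are bounded (by the sum of their norms). [folklore] -/
theorem exists_norm_coeff_coe_le {R : Type*} [CommRing R] (φ : R →+* ℂ_[p]) (w : R[X]) :
    ∃ C : ℝ, ∀ k, ‖φ (PowerSeries.coeff k (w : PowerSeries R))‖ ≤ C := by
  refine ⟨∑ i ∈ Finset.range (w.natDegree + 1), ‖φ (w.coeff i)‖, fun k ↦ ?_⟩
  rw [Polynomial.coeff_coe]
  by_cases hk : k < w.natDegree + 1
  · exact Finset.single_le_sum (f := fun i ↦ ‖φ (w.coeff i)‖) (fun i _ ↦ norm_nonneg _) (Finset.mem_range.mpr hk)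
  · rw [Polynomial.coeff_eq_zero_of_natDegree_lt (by omega), map_zero, norm_zero]
    exact Finset.sum_nonneg fun i _ ↦ norm_nonneg _

omit [Fact p.Prime] in
/-- `ω_n(ζ − 1) = 0` for `ζ^{pⁿ} = 1`. [cite: Washington1997, §7.2] -/
theorem eval₂_cyclotomicOmega_sub_one_eq_zero {T : Type*} [CommRing T] (φ : ℤ →+* T) (n : ℕ) {ζ : T}
    (hζ : ζ ^ p ^ n = 1) : (cyclotomicOmega p n).eval₂ φ (ζ - 1) = 0 := by
  rw [cyclotomicOmega, eval₂_sub, eval₂_pow, eval₂_add, eval₂_X, eval₂_one, sub_add_cancel, hζ, sub_self]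

/-- **Coefficients of a product of bounded series are bounded** in `ℂ_p` (ultrametric: `‖Σ_{i+j=n} φ(a_i)φ(b_j)‖ ≤ C·C'`). [folklore] -/
theorem norm_map_coeff_mul_le {R : Type*} [CommRing R] (φ : R →+* ℂ_[p]) {A B : PowerSeries R} {C C' : ℝ}
    (hA : ∀ k, ‖φ (PowerSeries.coeff k A)‖ ≤ C) (hB : ∀ k, ‖φ (PowerSeries.coeff k B)‖ ≤ C') (n : ℕ) :
    ‖φ (PowerSeries.coeff n (A * B))‖ ≤ C * C' := by
  have hC : 0 ≤ C := (norm_nonneg _).trans (hA 0)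
  have hC' : 0 ≤ C' := (norm_nonneg _).trans (hB 0)
  rw [PowerSeries.coeff_mul, map_sum]
  refine IsUltrametricDist.norm_sum_le_of_forall_le_of_nonneg (mul_nonneg hC hC') fun ij _ ↦ ?_
  rw [map_mul, norm_mul]
  exact mul_le_mul (hA _) (hB _) (norm_nonneg _) hC

/-- **H7 (k1-g3). An `ω_n`-congruence in `𝒪⟦T⟧ ⊗ ℚ` EVALUATES at the `pⁿ`-th roots of unity.** If
`IsCongrModOmegaO S n θ (w·L)` (`p^m(θ − w·L) = ω_n·q` in `ℚ̄_p⟦T⟧`, `L, q ∈ 𝒪⟦T⟧`, `θ, w` polynomials) and `ζ^{pⁿ} = 1` in `ℂ_p`, then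
`θ(ζ−1) = w(ζ−1)·L(ζ−1)` (`L(z) = Σ_k ι(L_k) z^k`; evaluation on the open unit disc is additive and multiplicative on bounded series,
`ω_n(ζ−1) = 0`, `p^m ≠ 0`). Applied at a primitive character of an even level to the plus Coleman value (`SignedColemanImage.exists_plusValue_*`)
and to `IsPollackPairK`, the common factor `ω⁻_{2m}(ζ−1) ≠ 0` cancels in the cross-ratio of H6. (The `𝒪`-sibling of the tree's
`tsum_coeff_eq_eval₂_of_omega_dvd_sub`.) [cite: Pollack2003, Prop. 6.18] [cite: Washington1997, Prop. 7.2 and §7.2] -/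
theorem eval₂_eq_mul_tsum_of_isCongrModOmegaO {n : ℕ} {θ w : (PadicAlgCl p)[X]} {L : IwasawaAlgebraO S}
    (h : IsCongrModOmegaO S n θ ((w : PowerSeries (PadicAlgCl p)) * iwasawaOToPowerSeries S L))
    {ζ : ℂ_[p]} (hζ : ζ ^ p ^ n = 1) :
    θ.eval₂ (algebraMap (PadicAlgCl p) ℂ_[p]) (ζ - 1) =
      w.eval₂ (algebraMap (PadicAlgCl p) ℂ_[p]) (ζ - 1) *
        ∑' k, ((algebraMap (PadicAlgCl p) ℂ_[p]).comp (padicCoeffIntegers S).subtype) (PowerSeries.coeff k L) * (ζ - 1) ^ k := by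
  set φ : PadicAlgCl p →+* ℂ_[p] := algebraMap (PadicAlgCl p) ℂ_[p] with hφ
  set z : ℂ_[p] := ζ - 1 with hz
  have hz1 : ‖z‖ < 1 := norm_sub_one_lt_one_of_pow_prime_pow_eq_one (p := p) hζ
  obtain ⟨m, q, hmq⟩ := h
  set c : PadicAlgCl p := (p : PadicAlgCl p) ^ m with hc
  set ιL := iwasawaOToPowerSeries S L with hιL
  set ιq := iwasawaOToPowerSeries S q with hιq
  set ω : (PadicAlgCl p)[X] := (cyclotomicOmega p n).map (Int.castRingHom (PadicAlgCl p)) with hω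
  -- the congruence, rearranged: `↑(C c·θ) − ↑(C c·w)·ιL = ↑ω·ιq`
  have hmq' : ((Polynomial.C c * θ : (PadicAlgCl p)[X]) : PowerSeries (PadicAlgCl p)) -
      ((Polynomial.C c * w : (PadicAlgCl p)[X]) : PowerSeries (PadicAlgCl p)) * ιL = (ω : PowerSeries (PadicAlgCl p)) * ιq := by
    rw [← hmq, Polynomial.coe_mul, Polynomial.coe_mul, Polynomial.coe_C]; ring
  -- coefficient bounds
  have hL : ∀ k, ‖φ (PowerSeries.coeff k ιL)‖ ≤ 1 := fun k ↦
    (PadicComplex.norm_extends (p := p) _).trans_le (norm_coeff_iwasawaOToPowerSeries_le_one S L k)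
  have hq : ∀ k, ‖φ (PowerSeries.coeff k ιq)‖ ≤ 1 := fun k ↦
    (PadicComplex.norm_extends (p := p) _).trans_le (norm_coeff_iwasawaOToPowerSeries_le_one S q k)
  obtain ⟨Cw, hw⟩ := exists_norm_coeff_coe_le φ (Polynomial.C c * w)
  obtain ⟨Cω, hωb⟩ := exists_norm_coeff_coe_le φ ω
  -- the three evaluations
  have h1 : HasSum (fun k ↦ φ (PowerSeries.coeff k ((Polynomial.C c * θ : (PadicAlgCl p)[X]) : PowerSeries (PadicAlgCl p))) * z ^ k)
      ((Polynomial.C c * θ).eval₂ φ z) := hasSum_map_coeff_coe_mul_pow φ _ z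
  have h2 : HasSum (fun k ↦ φ (PowerSeries.coeff k
      (((Polynomial.C c * w : (PadicAlgCl p)[X]) : PowerSeries (PadicAlgCl p)) * ιL)) * z ^ k)
      ((Polynomial.C c * w).eval₂ φ z * ∑' k, φ (PowerSeries.coeff k ιL) * z ^ k) := by
    have hs := (summable_map_coeff_mul_pow φ (norm_map_coeff_mul_le φ hw hL) hz1).hasSum
    rwa [tsum_map_coeff_mul_mul_pow φ hw hL hz1, (hasSum_map_coeff_coe_mul_pow φ (Polynomial.C c * w) z).tsum_eq] at hs
  have h3 : HasSum (fun k ↦ φ (PowerSeries.coeff k ((ω : PowerSeries (PadicAlgCl p)) * ιq)) * z ^ k) 0 := by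
    have hs := (summable_map_coeff_mul_pow φ (norm_map_coeff_mul_le φ hωb hq) hz1).hasSum
    have hω0 : ω.eval₂ φ z = 0 := by
      rw [hω, Polynomial.eval₂_map, RingHom.ext_int (φ.comp (Int.castRingHom (PadicAlgCl p))) (Int.castRingHom ℂ_[p]),
        eval₂_cyclotomicOmega_sub_one_eq_zero (Int.castRingHom ℂ_[p]) n hζ]
    rwa [tsum_map_coeff_mul_mul_pow φ hωb hq hz1, (hasSum_map_coeff_coe_mul_pow φ ω z).tsum_eq, hω0, zero_mul] at hs
  -- compare
  have h12 := h1.sub h2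
  have hfun : (fun k ↦ φ (PowerSeries.coeff k ((Polynomial.C c * θ : (PadicAlgCl p)[X]) : PowerSeries (PadicAlgCl p))) * z ^ k -
      φ (PowerSeries.coeff k (((Polynomial.C c * w : (PadicAlgCl p)[X]) : PowerSeries (PadicAlgCl p)) * ιL)) * z ^ k) =
      fun k ↦ φ (PowerSeries.coeff k ((ω : PowerSeries (PadicAlgCl p)) * ιq)) * z ^ k := by
    funext k
    rw [← hmq', map_sub, map_sub, sub_mul]
  rw [hfun] at h12
  have hzero := h12.unique h3
  -- cancel `φ(p^m) ≠ 0`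
  rw [Polynomial.eval₂_mul, Polynomial.eval₂_C, Polynomial.eval₂_mul, Polynomial.eval₂_C, mul_assoc, ← mul_sub,
    mul_eq_zero] at hzero
  have hc0 : φ c ≠ 0 := by
    rw [hc, map_pow, map_natCast]
    exact pow_ne_zero _ (Nat.cast_ne_zero.mpr (Fact.out : p.Prime).ne_zero)
  have key := sub_eq_zero.mp (hzero.resolve_left hc0)
  rw [key]
  rfl


/-- **H7′ (norm form)** — the only form §A/§B consume: `‖θ(ζ−1)‖ = ‖w(ζ−1)‖·‖L(ζ−1)‖`. [cite: Pollack2003, Prop. 6.18] -/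
theorem norm_eval₂_eq_of_isCongrModOmegaO {n : ℕ} {θ w : (PadicAlgCl p)[X]} {L : IwasawaAlgebraO S}
    (h : IsCongrModOmegaO S n θ ((w : PowerSeries (PadicAlgCl p)) * iwasawaOToPowerSeries S L))
    {ζ : ℂ_[p]} (hζ : ζ ^ p ^ n = 1) :
    ‖θ.eval₂ (algebraMap (PadicAlgCl p) ℂ_[p]) (ζ - 1)‖ =
      ‖w.eval₂ (algebraMap (PadicAlgCl p) ℂ_[p]) (ζ - 1)‖ *
        ‖∑' k, ((algebraMap (PadicAlgCl p) ℂ_[p]).comp (padicCoeffIntegers S).subtype) (PowerSeries.coeff k L) * (ζ - 1) ^ k‖ := by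
  rw [eval₂_eq_mul_tsum_of_isCongrModOmegaO S h hζ, norm_mul]

end Eval

end Summit.BirchSwinnertonDyer.BirchSwinnertonDyer.Theorems.NormLambdaSocket

end
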